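import Summits.CriticalPhenomena.PercolationContinuityZ3.Theorems.PercNearOneGluingNoHeavyLowerTailSahiCTCLadderPrep
import HarnessLib

/-!
# `NoHeavyLowerTail` (crux stmt-CriticalPhenomena-4575), P3 lane: the SMALL-WORLD FORM IS NONNEGATIVE FOR INDEPENDENT SUPPORTS —
# `X_{<t}·Z_{<t} − Θ_{t−1}·Y_{<t} ∈ ℕ[s]` for up-sets determined by disjoint coordinate sets, every `t` (memo g27 §5(b); = NAc({N<t}) of memo g28 §2)

Support file (seat `prim-l12-p3`, gen 28; `--supports stmt-CriticalPhenomena-4575`).  Memos `run/shared/lean/prim/prim-l12/FROM-prim-l12-p3-g27-RT-MONOTONICITY.md`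
§5(b) and `…-g28-TRANSFER-PRINCIPLE.md` §2.  For up-sets `𝒳, 𝒵 ⊆ 2^α` with membership in `𝒳` depending only on the coordinates in `I` and in `𝒵` only on
those outside `I`, every coefficient of `GF(𝒳_{<t})·GF(𝒵_{<t}) − GF(sets of size < t)·GF((𝒳∩𝒵)_{<t})` is `≥ 0` (`coeff_smallWorld_nonneg_of_determined`;
value level: `P(𝒳|N<t)·P(𝒵|N<t) ≥ P(𝒳∩𝒵|N<t)`, budget-conditioned negative correlation).  PROOF ("LYM / mirror"): at a profile `n ≤ 2` (doubled set `D`,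
single set `s`) both coefficients count subsets of `s` (`…LadderPrep.coeff_gf_mul_gf_eq_card_tr`); splitting `s` along `I` they become
`#{(A,B) ∈ 𝒜×ℬ : P(#A+#B)}` and `#{(A,B) : P(#A + n_J − #B)}` for the two traces `𝒜, ℬ` and a band predicate `P` (an interval symmetric under
`x ↦ n_I+n_J−x`) — `card_Rset_eq`, `card_Lset_eq`; the comparison `band_reflect_sum_le` is LYM at complementary levels
(`…WeightedLYM.card_level_le_card_level_of_isUpperSet`, via `card_trace_level_le`) for both traces, through `sum_antisymm_mul_nonneg` used twice.
With `…SahiCTCRtForm.coeff_Rt_nonneg_of_Nt` this is `R_t ∈ ℕ[s]` for independent-support pairs, every `t`.  Nothing is asserted about the crux.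
-/

namespace Summit.CriticalPhenomena.PercolationContinuityZ3.Theorems.SahiCTCForms

open Finset MvPolynomial SahiCTCGenFun SahiCTCWeightedLYM

variable {α : Type*} [DecidableEq α] [Fintype α]
/-! ### Arithmetic: antisymmetric × co-oriented sums, and the band reflection inequality -/

omit [DecidableEq α] [Fintype α] in
/-- If `f` is antisymmetric under `a ↦ N − a` and `f a·(g a − g (N−a)) ≥ 0` on the lower half, then `Σ_{a ≤ N} f a · g a ≥ 0`. [this work] -/
theorem sum_antisymm_mul_nonneg (N : ℕ) (f g : ℕ → ℤ) (hf : ∀ a, a ≤ N → f (N - a) = - f a)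
    (hfg : ∀ a, a ≤ N → 2 * a ≤ N → 0 ≤ f a * (g a - g (N - a))) :
    0 ≤ ∑ a ∈ range (N + 1), f a * g a := by
  set S := ∑ a ∈ range (N + 1), f a * g a with hS
  have hrefl : ∑ a ∈ range (N + 1), f (N - a) * g (N - a) = S := by
    have h := Finset.sum_range_reflect (fun a => f a * g a) (N + 1)
    simp only [Nat.add_sub_cancel] at h
    exact h
  have h1 : S = ∑ a ∈ range (N + 1), -(f a * g (N - a)) := by
    rw [← hrefl]
    refine sum_congr rfl fun a ha => ?_
    rw [mem_range] at ha
    rw [hf a (by omega)]; ring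
  have h2 : 2 * S = ∑ a ∈ range (N + 1), f a * (g a - g (N - a)) := by
    have : 2 * S = S + ∑ a ∈ range (N + 1), -(f a * g (N - a)) := by rw [← h1]; ring
    rw [this, hS, ← sum_add_distrib]
    exact sum_congr rfl fun a _ => by ring
  have h3 : 0 ≤ ∑ a ∈ range (N + 1), f a * (g a - g (N - a)) := by
    refine sum_nonneg fun a ha => ?_
    rw [mem_range] at ha
    by_cases h2a : 2 * a ≤ N
    · exact hfg a (by omega) h2a
    · have ha' : N - a ≤ N := Nat.sub_le N a
      have key := hfg (N - a) ha' (by omega)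
      rw [show N - (N - a) = a by omega, hf a (by omega)] at key
      have e : -f a * (g (N - a) - g a) = f a * (g a - g (N - a)) := by ring
      linarith
  linarith

omit [DecidableEq α] [Fintype α] in
/-- **Band reflection inequality.**  For level sequences `α` on `0..n_I` and `β` on `0..n_J` with the LYM symmetry (`α a ≤ α (n_I − a)` for
`2a ≤ n_I`, likewise `β`) and a band predicate `P` on `0..n_I+n_J` that is an interval symmetric under `x ↦ n_I + n_J − x`:
`Σ_{a,b} α_a β_b [P(a+b)] ≤ Σ_{a,b} α_a β_b [P(a + n_J − b)]` — reflecting one index across the middle does not decrease the band mass. [this work] -/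
theorem band_reflect_sum_le (nI nJ : ℕ) (wI wJ : ℕ → ℤ) (P : ℕ → Prop) [DecidablePred P]
    (hI : ∀ a, a ≤ nI → 2 * a ≤ nI → wI a ≤ wI (nI - a)) (hJ : ∀ b, b ≤ nJ → 2 * b ≤ nJ → wJ b ≤ wJ (nJ - b))
    (hPsymm : ∀ x, x ≤ nI + nJ → (P x ↔ P (nI + nJ - x)))
    (hPconv : ∀ x y z, x ≤ y → y ≤ z → P x → P z → P y) :
    ∑ a ∈ range (nI + 1), ∑ b ∈ range (nJ + 1), wI a * wJ b * (if P (a + b) then 1 else 0)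
      ≤ ∑ a ∈ range (nI + 1), ∑ b ∈ range (nJ + 1), wI a * wJ b * (if P (a + (nJ - b)) then 1 else 0) := by
  set ψ : ℕ → ℤ := fun x => ∑ a ∈ range (nI + 1), wI a * (if P (a + x) then 1 else 0) with hψ
  -- the inner window comparison: ψ (nJ - b) ≤ ψ b for 2b ≤ nJ
  have hwin : ∀ b, b ≤ nJ → 2 * b ≤ nJ → ψ (nJ - b) ≤ ψ b := by
    intro b hb h2b
    have hdiff : ψ b - ψ (nJ - b) = ∑ a ∈ range (nI + 1),
        ((if P (a + b) then (1 : ℤ) else 0) - (if P (a + (nJ - b)) then 1 else 0)) * wI a := by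
      simp only [hψ, ← sum_sub_distrib]
      exact sum_congr rfl fun a _ => by ring
    rw [← sub_nonneg, hdiff]
    refine sum_antisymm_mul_nonneg nI _ _ (fun a ha => ?_) (fun a ha h2a => ?_)
    · have e1 : P (nI - a + b) ↔ P (a + (nJ - b)) := by
        rw [hPsymm (nI - a + b) (by omega), show nI + nJ - (nI - a + b) = a + (nJ - b) by omega]
      have e2 : P (nI - a + (nJ - b)) ↔ P (a + b) := by
        rw [hPsymm (nI - a + (nJ - b)) (by omega), show nI + nJ - (nI - a + (nJ - b)) = a + b by omega]
      simp only [e1, e2]; ring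
    · have hδ : (if P (a + b) then (1 : ℤ) else 0) - (if P (a + (nJ - b)) then 1 else 0) ≤ 0 := by
        by_cases hp : P (a + b)
        · have hz : P (nI + nJ - (a + b)) := (hPsymm (a + b) (by omega)).1 hp
          have hq : P (a + (nJ - b)) := hPconv (a + b) (a + (nJ - b)) (nI + nJ - (a + b)) (by omega) (by omega) hp hz
          simp [hp, hq]
        · simp only [hp, if_false, zero_sub, Left.neg_nonpos_iff]
          split_ifs <;> norm_num
      have hw : wI a - wI (nI - a) ≤ 0 := sub_nonpos.2 (hI a ha h2a)
      have h := mul_nonneg (neg_nonneg.2 hδ) (neg_nonneg.2 hw)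
      rwa [neg_mul_neg] at h
  -- rewrite both sides as Σ_b (...)·ψ
  have hL : ∑ a ∈ range (nI + 1), ∑ b ∈ range (nJ + 1), wI a * wJ b * (if P (a + b) then 1 else 0)
      = ∑ b ∈ range (nJ + 1), wJ b * ψ b := by
    rw [sum_comm]
    refine sum_congr rfl fun b _ => ?_
    rw [hψ, mul_sum]
    exact sum_congr rfl fun a _ => by ring
  have hR : ∑ a ∈ range (nI + 1), ∑ b ∈ range (nJ + 1), wI a * wJ b * (if P (a + (nJ - b)) then 1 else 0)
      = ∑ b ∈ range (nJ + 1), wJ (nJ - b) * ψ b := by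
    rw [sum_comm]
    have h1 : ∑ b ∈ range (nJ + 1), ∑ a ∈ range (nI + 1), wI a * wJ b * (if P (a + (nJ - b)) then 1 else 0)
        = ∑ b ∈ range (nJ + 1), wJ b * ψ (nJ - b) := by
      refine sum_congr rfl fun b _ => ?_
      rw [hψ, mul_sum]
      exact sum_congr rfl fun a _ => by ring
    rw [h1]
    have h2 := Finset.sum_range_reflect (fun b => wJ (nJ - b) * ψ b) (nJ + 1)
    simp only [Nat.add_sub_cancel] at h2
    rw [← h2]
    refine sum_congr rfl fun b hb => ?_
    rw [mem_range] at hb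
    rw [show nJ - (nJ - b) = b by omega]
  rw [hL, hR, ← sub_nonneg, ← sum_sub_distrib]
  have h3 : ∑ b ∈ range (nJ + 1), (wJ (nJ - b) * ψ b - wJ b * ψ b) = ∑ b ∈ range (nJ + 1), (wJ (nJ - b) - wJ b) * ψ b :=
    sum_congr rfl fun b _ => by ring
  rw [h3]
  refine sum_antisymm_mul_nonneg nJ _ _ (fun b hb => ?_) (fun b hb h2b => ?_)
  · rw [show nJ - (nJ - b) = b by omega]; ring
  · exact mul_nonneg (sub_nonneg.2 (hJ b hb h2b)) (sub_nonneg.2 (hwin b hb h2b))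
/-! ### Double fibre counts -/

omit [DecidableEq α] [Fintype α] in
/-- Summing a function of the cardinality over a family = summing over the sizes with the level counts as weights. [this work] -/
theorem sum_card_fiber (𝒜 : Finset (Finset α)) {m : ℕ} (h𝒜 : ∀ A ∈ 𝒜, #A ≤ m) (F : ℕ → ℤ) :
    ∑ A ∈ 𝒜, F #A = ∑ a ∈ range (m + 1), (#(𝒜.filter fun A => #A = a) : ℤ) * F a := by
  rw [← sum_fiberwise_of_maps_to (s := 𝒜) (t := range (m + 1)) (g := fun A => #A)
    (fun A hA => mem_range.2 (Nat.lt_succ_of_le (h𝒜 A hA)))]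
  refine sum_congr rfl fun a _ => ?_
  rw [sum_congr rfl fun A hA => by rw [(mem_filter.1 hA).2], sum_const, nsmul_eq_mul]

omit [DecidableEq α] [Fintype α] in
/-- `#{(A,B) ∈ 𝒜×ℬ : Q(#A,#B)} = Σ_{a,b} #𝒜_a · #ℬ_b · [Q a b]`. [this work] -/
theorem card_filter_prod_eq_sum (𝒜 ℬ : Finset (Finset α)) {nI nJ : ℕ} (h𝒜 : ∀ A ∈ 𝒜, #A ≤ nI) (hℬ : ∀ B ∈ ℬ, #B ≤ nJ)
    (Q : ℕ → ℕ → Prop) [DecidableRel Q] :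
    (#((𝒜 ×ˢ ℬ).filter fun p => Q #p.1 #p.2) : ℤ) =
      ∑ a ∈ range (nI + 1), ∑ b ∈ range (nJ + 1),
        (#(𝒜.filter fun A => #A = a) : ℤ) * #(ℬ.filter fun B => #B = b) * (if Q a b then 1 else 0) := by
  rw [card_filter, Nat.cast_sum, sum_product]
  rw [sum_card_fiber 𝒜 h𝒜 (fun a => ∑ B ∈ ℬ, ((if Q a #B then 1 else 0 : ℕ) : ℤ))]
  · refine sum_congr rfl fun a _ => ?_
    rw [sum_card_fiber ℬ hℬ (fun b => ((if Q a b then 1 else 0 : ℕ) : ℤ)), mul_sum]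
    refine sum_congr rfl fun b _ => ?_
    push_cast; ring
/-! ### Trace levels are cube levels (for LYM) -/

omit [Fintype α] in
/-- The members of size `a` of the trace `{A ⊆ R : D ∪ A ∈ 𝒳}` (`D ∩ R = ∅`) are in bijection with the level `#D + a` of `𝒳` in the cube
`[D, D ∪ R]`. [this work] -/
theorem card_filter_powerset_eq_card_level (𝒳 : Finset (Finset α)) {D R : Finset α} (hDR : Disjoint D R) (a : ℕ) :
    #(((R.powerset.filter fun A => D ∪ A ∈ 𝒳)).filter fun A => #A = a) = #(level 𝒳 D (D ∪ R) (#D + a)) := by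
  refine card_bij (fun A _ => D ∪ A) (fun A hA => ?_) (fun A hA A' hA' h => ?_) (fun S hS => ?_)
  · rw [mem_filter, mem_filter, mem_powerset] at hA
    obtain ⟨⟨hAR, hAX⟩, hAa⟩ := hA
    rw [mem_level]
    refine ⟨hAX, subset_union_left, union_subset_union Subset.rfl hAR, ?_⟩
    rw [card_union_of_disjoint (hDR.mono_right hAR), hAa]
  · have hAR : A ⊆ R := mem_powerset.1 (mem_filter.1 (mem_filter.1 hA).1).1
    have hAR' : A' ⊆ R := mem_powerset.1 (mem_filter.1 (mem_filter.1 hA').1).1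
    have h1 : (D ∪ A) \ D = A := union_sdiff_cancel_left (hDR.mono_right hAR)
    have h2 : (D ∪ A') \ D = A' := union_sdiff_cancel_left (hDR.mono_right hAR')
    rw [← h1, ← h2, h]
  · rw [mem_level] at hS
    obtain ⟨hSX, hDS, hSDR, hSc⟩ := hS
    refine ⟨S \ D, mem_filter.2 ⟨mem_filter.2 ⟨mem_powerset.2 ?_, ?_⟩, ?_⟩, union_sdiff_of_subset hDS⟩
    · intro x hx
      rw [mem_sdiff] at hx
      rcases mem_union.1 (hSDR hx.1) with h | h
      · exact absurd h hx.2
      · exact h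
    · rw [union_sdiff_of_subset hDS]; exact hSX
    · rw [card_sdiff_of_subset hDS, hSc]; omega

omit [Fintype α] in
/-- **LYM symmetry for a trace**: for an up-set `𝒳`, `D ∩ R = ∅`, `2a ≤ #R`: `#{A ⊆ R : D ∪ A ∈ 𝒳, #A = a} ≤ #{… , #A = #R − a}`. [this work] -/
theorem card_trace_level_le (𝒳 : Finset (Finset α)) (h𝒳 : IsUpperSet (𝒳 : Set (Finset α))) {D R : Finset α} (hDR : Disjoint D R)
    {a : ℕ} (ha : a ≤ #R) (h2a : 2 * a ≤ #R) :
    #(((R.powerset.filter fun A => D ∪ A ∈ 𝒳)).filter fun A => #A = a) ≤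
      #(((R.powerset.filter fun A => D ∪ A ∈ 𝒳)).filter fun A => #A = #R - a) := by
  rw [card_filter_powerset_eq_card_level 𝒳 hDR, card_filter_powerset_eq_card_level 𝒳 hDR]
  have hcard : #(D ∪ R) = #D + #R := card_union_of_disjoint hDR
  exact card_level_le_card_level_of_isUpperSet h𝒳 subset_union_left (by omega) (by rw [hcard]; omega)
/-! ### The two bijections -/

section Bijections

variable {𝒳 𝒵 : Finset (Finset α)} {I D s : Finset α}

omit [Fintype α] in
/-- If membership in `𝒳` depends only on the `I`-coordinates then `D ∪ W ∈ 𝒳 ↔ D ∪ (W ∩ I) ∈ 𝒳`. [this work] -/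
theorem mem_iff_inter_of_determined (hX : ∀ S : Finset α, S ∈ 𝒳 ↔ S ∩ I ∈ 𝒳) (D W : Finset α) :
    D ∪ W ∈ 𝒳 ↔ D ∪ (W ∩ I) ∈ 𝒳 := by
  rw [hX (D ∪ W), hX (D ∪ (W ∩ I))]
  have : (D ∪ W) ∩ I = (D ∪ (W ∩ I)) ∩ I := by
    ext x; simp only [mem_inter, mem_union]; tauto
  rw [this]

omit [Fintype α] in
/-- If membership in `𝒵` depends only on the coordinates outside `I` then `D ∪ W ∈ 𝒵 ↔ D ∪ (W \ I) ∈ 𝒵`. [this work] -/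
theorem mem_iff_sdiff_of_determined (hZ : ∀ S : Finset α, S ∈ 𝒵 ↔ S \ I ∈ 𝒵) (D W : Finset α) :
    D ∪ W ∈ 𝒵 ↔ D ∪ (W \ I) ∈ 𝒵 := by
  rw [hZ (D ∪ W), hZ (D ∪ (W \ I))]
  have : (D ∪ W) \ I = (D ∪ (W \ I)) \ I := by
    ext x; simp only [mem_sdiff, mem_union]; tauto
  rw [this]

omit [Fintype α] in
/-- **R-side bijection** `W ↦ (W ∩ I, W \ I)`: subsets `W ⊆ s` with `D ∪ W ∈ 𝒳 ∩ 𝒵` and a size condition `P(#W)` correspond to pairs of trace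
members `(A,B)` with `P(#A + #B)`. [this work] -/
theorem card_Rset_eq (hX : ∀ S : Finset α, S ∈ 𝒳 ↔ S ∩ I ∈ 𝒳) (hZ : ∀ S : Finset α, S ∈ 𝒵 ↔ S \ I ∈ 𝒵)
    (P : ℕ → Prop) [DecidablePred P] :
    #(s.powerset.filter fun W => (D ∪ W ∈ 𝒳 ∧ D ∪ W ∈ 𝒵) ∧ P #W) =
      #((((s ∩ I).powerset.filter fun A => D ∪ A ∈ 𝒳) ×ˢ ((s \ I).powerset.filter fun B => D ∪ B ∈ 𝒵)).filter
        fun p => P (#p.1 + #p.2)) := by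
  refine card_bij (fun W _ => (W ∩ I, W \ I)) (fun W hW => ?_) (fun W hW W' hW' h => ?_) (fun p hp => ?_)
  · rw [mem_filter, mem_powerset] at hW
    obtain ⟨hWs, ⟨hWX, hWZ⟩, hP⟩ := hW
    refine mem_filter.2 ⟨mem_product.2 ⟨mem_filter.2 ⟨mem_powerset.2 (inter_subset_inter hWs Subset.rfl), ?_⟩,
      mem_filter.2 ⟨mem_powerset.2 (sdiff_subset_sdiff hWs Subset.rfl), ?_⟩⟩, ?_⟩
    · exact (mem_iff_inter_of_determined hX D W).1 hWX
    · exact (mem_iff_sdiff_of_determined hZ D W).1 hWZ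
    · simp only; rw [← card_union_of_disjoint (disjoint_sdiff_inter W I).symm, union_comm, sdiff_union_inter]; exact hP
  · simp only [Prod.mk.injEq] at h
    rw [← sdiff_union_inter W I, ← sdiff_union_inter W' I, h.1, h.2]
  · obtain ⟨A, B⟩ := p
    rw [mem_filter, mem_product, mem_filter, mem_filter, mem_powerset, mem_powerset] at hp
    obtain ⟨⟨⟨hA, hAX⟩, hB, hBZ⟩, hP⟩ := hp
    have hAI : A ⊆ I := fun x hx => (mem_inter.1 (hA hx)).2
    have hBI : Disjoint B I := disjoint_left.2 fun x hx => (mem_sdiff.1 (hB hx)).2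
    have hAB : Disjoint A B := disjoint_left.2 fun x hxA hxB => (mem_sdiff.1 (hB hxB)).2 (hAI hxA)
    have e1 : (A ∪ B) ∩ I = A := by
      rw [union_inter_distrib_right, inter_eq_left.2 hAI, disjoint_iff_inter_eq_empty.1 hBI, union_empty]
    have e2 : (A ∪ B) \ I = B := by
      rw [union_sdiff_distrib, sdiff_eq_empty_iff_subset.2 hAI, empty_union, Finset.sdiff_eq_self_of_disjoint hBI]
    refine ⟨A ∪ B, mem_filter.2 ⟨mem_powerset.2 (union_subset (fun x hx => (mem_inter.1 (hA hx)).1)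
      (fun x hx => (mem_sdiff.1 (hB hx)).1)), ⟨?_, ?_⟩, ?_⟩, ?_⟩
    · rw [mem_iff_inter_of_determined hX, e1]; exact hAX
    · rw [mem_iff_sdiff_of_determined hZ, e2]; exact hBZ
    · rw [card_union_of_disjoint hAB]; exact hP
    · simp only [e1, e2]

omit [Fintype α] in
/-- **L-side bijection** `U ↦ (U ∩ I, (s \ U) \ I)`: subsets `U ⊆ s` with `D ∪ U ∈ 𝒳`, `D ∪ (s \ U) ∈ 𝒵` and `P(#U)` correspond to pairs of trace
members `(A,B)` with `P(#A + (n_J − #B))`, `n_J = #(s \ I)`. [this work] -/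
theorem card_Lset_eq (hX : ∀ S : Finset α, S ∈ 𝒳 ↔ S ∩ I ∈ 𝒳) (hZ : ∀ S : Finset α, S ∈ 𝒵 ↔ S \ I ∈ 𝒵)
    (P : ℕ → Prop) [DecidablePred P] :
    #(s.powerset.filter fun U => (D ∪ U ∈ 𝒳 ∧ D ∪ (s \ U) ∈ 𝒵) ∧ P #U) =
      #((((s ∩ I).powerset.filter fun A => D ∪ A ∈ 𝒳) ×ˢ ((s \ I).powerset.filter fun B => D ∪ B ∈ 𝒵)).filter
        fun p => P (#p.1 + (#(s \ I) - #p.2))) := by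
  refine card_bij (fun U _ => (U ∩ I, (s \ U) \ I)) (fun U hU => ?_) (fun U hU U' hU' h => ?_) (fun p hp => ?_)
  · rw [mem_filter, mem_powerset] at hU
    obtain ⟨hUs, ⟨hUX, hUZ⟩, hP⟩ := hU
    refine mem_filter.2 ⟨mem_product.2 ⟨mem_filter.2 ⟨mem_powerset.2 (inter_subset_inter hUs Subset.rfl), ?_⟩,
      mem_filter.2 ⟨mem_powerset.2 (sdiff_subset_sdiff sdiff_subset Subset.rfl), ?_⟩⟩, ?_⟩
    · exact (mem_iff_inter_of_determined hX D U).1 hUX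
    · exact (mem_iff_sdiff_of_determined hZ D (s \ U)).1 hUZ
    · simp only
      have hsub : (s \ U) \ I ⊆ s \ I := sdiff_subset_sdiff sdiff_subset Subset.rfl
      have e : #(U ∩ I) + (#(s \ I) - #((s \ U) \ I)) = #U := by
        have h1 : #((s \ U) \ I) + #(U \ I) = #(s \ I) := by
          rw [← card_union_of_disjoint]
          · congr 1; ext x; simp only [mem_union, mem_sdiff]
            constructor
            · rintro (⟨⟨hxs, _⟩, hxI⟩ | ⟨hxU, hxI⟩)
              · exact ⟨hxs, hxI⟩
              · exact ⟨hUs hxU, hxI⟩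
            · rintro ⟨hxs, hxI⟩
              by_cases hxU : x ∈ U
              · exact Or.inr ⟨hxU, hxI⟩
              · exact Or.inl ⟨⟨hxs, hxU⟩, hxI⟩
          · exact disjoint_left.2 fun x h1 h2 => (mem_sdiff.1 (mem_sdiff.1 h1).1).2 (mem_sdiff.1 h2).1
        have h2 : #(U ∩ I) + #(U \ I) = #U := by
          rw [← card_union_of_disjoint (disjoint_sdiff_inter U I).symm, union_comm, sdiff_union_inter]
        omega
      rw [e]; exact hP
  · simp only [Prod.mk.injEq] at h
    obtain ⟨h1, h2⟩ := h
    have hUs : U ⊆ s := mem_powerset.1 (mem_filter.1 hU).1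
    have hU's : U' ⊆ s := mem_powerset.1 (mem_filter.1 hU').1
    -- recover `U \ I` from `(s \ U) \ I`
    have e : ∀ V : Finset α, V ⊆ s → V \ I = (s \ I) \ ((s \ V) \ I) := fun V hVs => by
      ext x; simp only [mem_sdiff]
      constructor
      · rintro ⟨hxV, hxI⟩; exact ⟨⟨hVs hxV, hxI⟩, fun h => h.1.2 hxV⟩
      · rintro ⟨⟨hxs, hxI⟩, h⟩
        refine ⟨?_, hxI⟩
        by_contra hxV; exact h ⟨⟨hxs, hxV⟩, hxI⟩
    have e3 : U \ I = U' \ I := by rw [e U hUs, e U' hU's, h2]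
    rw [← sdiff_union_inter U I, ← sdiff_union_inter U' I, h1, e3]
  · obtain ⟨A, B⟩ := p
    rw [mem_filter, mem_product, mem_filter, mem_filter, mem_powerset, mem_powerset] at hp
    obtain ⟨⟨⟨hA, hAX⟩, hB, hBZ⟩, hP⟩ := hp
    have hAI : A ⊆ I := fun x hx => (mem_inter.1 (hA hx)).2
    have hAs : A ⊆ s := fun x hx => (mem_inter.1 (hA hx)).1
    set C := (s \ I) \ B with hC
    have hCs : C ⊆ s := fun x hx => (mem_sdiff.1 (mem_sdiff.1 hx).1).1
    have hCI : Disjoint C I := disjoint_left.2 fun x hx => (mem_sdiff.1 (mem_sdiff.1 hx).1).2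
    have hAC : Disjoint A C := disjoint_left.2 fun x hxA hxC => (disjoint_left.1 hCI hxC) (hAI hxA)
    have e1 : (A ∪ C) ∩ I = A := by
      rw [union_inter_distrib_right, inter_eq_left.2 hAI, disjoint_iff_inter_eq_empty.1 hCI, union_empty]
    have e2 : (s \ (A ∪ C)) \ I = B := by
      ext x; simp only [mem_sdiff, mem_union, hC, not_or]
      constructor
      · rintro ⟨⟨hxs, hxA, hxC⟩, hxI⟩
        by_contra hxB; exact hxC ⟨⟨hxs, hxI⟩, hxB⟩
      · intro hxB
        have hx := mem_sdiff.1 (hB hxB)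
        exact ⟨⟨hx.1, fun hxA => hx.2 (hAI hxA), fun h => h.2 hxB⟩, hx.2⟩
    have e3 : #C = #(s \ I) - #B := by rw [hC, card_sdiff_of_subset hB]
    refine ⟨A ∪ C, mem_filter.2 ⟨mem_powerset.2 (union_subset hAs hCs), ⟨?_, ?_⟩, ?_⟩, ?_⟩
    · rw [mem_iff_inter_of_determined hX, e1]; exact hAX
    · rw [mem_iff_sdiff_of_determined hZ, e2]; exact hBZ
    · rw [card_union_of_disjoint hAC, e3]; exact hP
    · simp only [e1, e2]

end Bijections
/-! ### The theorem -/

/-- **THE SMALL-WORLD FORM IS NONNEGATIVE FOR INDEPENDENT SUPPORTS** (memo g27 §5(b); the hypothesis NAc({N<t}) of the transfer principle, memo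
g28 §2): for up-sets `𝒳, 𝒵` with `S ∈ 𝒳 ↔ S ∩ I ∈ 𝒳` and `S ∈ 𝒵 ↔ S \ I ∈ 𝒵`, every coefficient of
`GF(𝒳_{<t})·GF(𝒵_{<t}) − GF(sets of size < t)·GF((𝒳∩𝒵)_{<t})` is `≥ 0`. [this work] -/
theorem coeff_smallWorld_nonneg_of_determined {𝒳 𝒵 : Finset (Finset α)} (h𝒳 : IsUpperSet (𝒳 : Set (Finset α)))
    (h𝒵 : IsUpperSet (𝒵 : Set (Finset α))) {I : Finset α} (hX : ∀ S : Finset α, S ∈ 𝒳 ↔ S ∩ I ∈ 𝒳)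
    (hZ : ∀ S : Finset α, S ∈ 𝒵 ↔ S \ I ∈ 𝒵) (t : ℕ) (n : α →₀ ℕ) :
    0 ≤ (gf (𝒳.filter fun S => #S < t) * gf (𝒵.filter fun S => #S < t)
      - gf (univ.powerset.filter fun S : Finset α => #S < t) * gf ((𝒳 ∩ 𝒵).filter fun S => #S < t)).coeff n := by
  rw [coeff_sub, sub_nonneg]
  by_cases hn : ∀ i, n i ≤ 2
  swap
  · rw [coeff_gf_mul_gf, coeff_gf_mul_gf, filter_prod_eq_empty _ _ n hn, filter_prod_eq_empty _ _ n hn]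
  rw [coeff_gf_mul_gf_eq_card_tr _ _ hn, coeff_gf_mul_gf_eq_card_tr _ _ hn]
  set D := dbl n with hD
  set s := sgl n with hs
  have hDs : Disjoint D s := disjoint_dbl_sgl n
  -- the band predicate
  set P : ℕ → Prop := fun x => #D + x < t ∧ #D + #s < t + x with hPdef
  have hcardDU : ∀ U, U ⊆ s → #(D ∪ U) = #D + #U := fun U hU => card_union_of_disjoint (hDs.mono_right hU)
  have hcompl : ∀ U, U ⊆ s → #(D ∪ (s \ U)) = #D + #s - #U := fun U hU => by
    rw [hcardDU _ sdiff_subset, card_sdiff_of_subset hU]; have := card_le_card hU; omega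
  -- rewrite the R-side count (second product) : U ↦ s \ U, then the R-bijection
  have hR : #((tr (univ.powerset.filter fun S : Finset α => #S < t) D s).filter
        fun U => s \ U ∈ tr ((𝒳 ∩ 𝒵).filter fun S => #S < t) D s)
      = #(s.powerset.filter fun W => (D ∪ W ∈ 𝒳 ∧ D ∪ W ∈ 𝒵) ∧ P #W) := by
    refine card_bij (fun U _ => s \ U) (fun U hU => ?_) (fun U hU U' hU' h => ?_) (fun W hW => ?_)
    · rw [mem_filter, mem_tr, mem_tr, mem_filter, mem_filter, mem_inter] at hU
      obtain ⟨⟨hUs, _, hU1⟩, _, ⟨hWX, hWZ⟩, hU2⟩ := hU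
      refine mem_filter.2 ⟨mem_powerset.2 sdiff_subset, ⟨hWX, hWZ⟩, ?_⟩
      simp only [hPdef]
      rw [hcardDU U hUs] at hU1; rw [hcompl U hUs] at hU2
      rw [card_sdiff_of_subset hUs]; have := card_le_card hUs; omega
    · have h1 : U ⊆ s := (mem_tr.1 (mem_filter.1 hU).1).1
      have h2 : U' ⊆ s := (mem_tr.1 (mem_filter.1 hU').1).1
      rw [← Finset.sdiff_sdiff_eq_self h1, h, Finset.sdiff_sdiff_eq_self h2]
    · rw [mem_filter, mem_powerset] at hW
      obtain ⟨hWs, ⟨hWX, hWZ⟩, hP⟩ := hW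
      simp only [hPdef] at hP
      have hW' : s \ (s \ W) = W := Finset.sdiff_sdiff_eq_self hWs
      refine ⟨s \ W, mem_filter.2 ⟨mem_tr.2 ⟨sdiff_subset, mem_filter.2 ⟨mem_powerset.2 (subset_univ _), ?_⟩⟩,
        mem_tr.2 ⟨sdiff_subset, mem_filter.2 ⟨mem_inter.2 ⟨?_, ?_⟩, ?_⟩⟩⟩, hW'⟩
      · rw [hcompl W hWs]; have := card_le_card hWs; omega
      · rw [hW']; exact hWX
      · rw [hW']; exact hWZ
      · rw [hW', hcardDU W hWs]; omega
  -- rewrite the L-side count (first product)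
  have hL : #((tr (𝒳.filter fun S => #S < t) D s).filter fun U => s \ U ∈ tr (𝒵.filter fun S => #S < t) D s)
      = #(s.powerset.filter fun U => (D ∪ U ∈ 𝒳 ∧ D ∪ (s \ U) ∈ 𝒵) ∧ P #U) := by
    congr 1; ext U
    simp only [mem_filter, mem_tr, mem_powerset, hPdef]
    constructor
    · rintro ⟨⟨hUs, hUX, hU1⟩, _, hUZ, hU2⟩
      rw [hcardDU U hUs] at hU1; rw [hcompl U hUs] at hU2
      have := card_le_card hUs
      exact ⟨hUs, ⟨hUX, hUZ⟩, hU1, by omega⟩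
    · rintro ⟨hUs, ⟨hUX, hUZ⟩, hU1, hU2⟩
      have := card_le_card hUs
      refine ⟨⟨hUs, hUX, by rw [hcardDU U hUs]; exact hU1⟩, sdiff_subset, hUZ, by rw [hcompl U hUs]; omega⟩
  rw [hR, hL, card_Rset_eq hX hZ P, card_Lset_eq hX hZ P]
  -- level counts and the arithmetic inequality
  set 𝒜 := (s ∩ I).powerset.filter fun A => D ∪ A ∈ 𝒳 with h𝒜
  set ℬ := (s \ I).powerset.filter fun B => D ∪ B ∈ 𝒵 with hℬ
  have h𝒜card : ∀ A ∈ 𝒜, #A ≤ #(s ∩ I) := fun A hA => card_le_card (mem_powerset.1 (mem_filter.1 hA).1)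
  have hℬcard : ∀ B ∈ ℬ, #B ≤ #(s \ I) := fun B hB => card_le_card (mem_powerset.1 (mem_filter.1 hB).1)
  have e1 := card_filter_prod_eq_sum 𝒜 ℬ h𝒜card hℬcard (fun a b => P (a + b))
  have e2 := card_filter_prod_eq_sum 𝒜 ℬ h𝒜card hℬcard (fun a b => P (a + (#(s \ I) - b)))
  have key := band_reflect_sum_le (#(s ∩ I)) (#(s \ I)) (fun a => (#(𝒜.filter fun A => #A = a) : ℤ))
    (fun b => (#(ℬ.filter fun B => #B = b) : ℤ)) P (fun a ha h2a => ?_) (fun b hb h2b => ?_) (fun x hx => ?_) (fun x y z hxy hyz hx hz => ?_)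
  · have h := le_trans (le_of_eq e1) (le_trans key (le_of_eq e2.symm))
    exact_mod_cast h
  · exact_mod_cast card_trace_level_le 𝒳 h𝒳 (hDs.mono_right inter_subset_left) ha h2a
  · exact_mod_cast card_trace_level_le 𝒵 h𝒵 (hDs.mono_right sdiff_subset) hb h2b
  · have hsI : #(s ∩ I) + #(s \ I) = #s := by
      rw [← card_union_of_disjoint (disjoint_sdiff_inter s I).symm, union_comm, sdiff_union_inter]
    simp only [hPdef]; rw [hsI] at hx ⊢; omega
  · simp only [hPdef] at hx hz ⊢; omega

end Summit.CriticalPhenomena.PercolationContinuityZ3.Theorems.SahiCTCForms
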